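import Summits.CriticalPhenomena.PercolationContinuityZ3.Theorems.PercNearOneGluingNoHeavyConstsDualHnu
import Summits.CriticalPhenomena.PercolationContinuityZ3.Theorems.PercNearOneGluingNoHeavyConstsHnuMDLXIdentity
import HarnessLib

/-!
# Consequences of the dual observer conjecture: H-ν for every monotone functional, and `Consts.MDLXJoint` at every up-event that does
# not raise the three-way link probability   (PAPER-2 track (ii); seat `prim-consts-2`, gen 14)

builds on p205010 (kernel theorem, internal audit signed; external expert review pending).  Support file (`--supports
stmt-CriticalPhenomena-4575`); memo `run/shared/lean/prim/consts/FROM-prim-consts-2-g14-DUAL-HNU.md` §2–§3.  No definitions, no named facts, no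
sorries; standard axioms; apart from the identity `Consts.mdlx_eq_hnu_add`, every theorem here takes the typed conjecture `Consts.AvoidedClusterRepulsion`
(`…ConstsDualHnu.lean`) as a hypothesis.

Notation: owner `s`, avoided set `X`, markers `y, z`; `D = {s ↮ X}`, `T = {y ↮ {s}∪X} ∩ D`, `W = {y ↔ z}`, `Y = {s↔y}`, `Z = {s↔z}`,
`G_y = {y ↔ X}`, `B' = Z ∪ (W ∩ {y ↮ X})`, `p' = μ(T∩W)/μ(T)`, `ν = μ(·|D)`.

* `Consts.hnu_of_avoidedClusterRepulsion` — **dual H-ν ⟹ H-ν for EVERY monotone functional `F` of `C_s`**: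
  `0 ≤ μ(T)·[μ(D)∫_{D∩B'} F(C_s) − (∫_D F(C_s)) μ(D∩B')] + μ(T∩W)·[μ(D)∫_{D∩G_y} F(C_s) − (∫_D F(C_s)) μ(D∩G_y)]`
  (`Cov_ν(F, 1_{B'}) + p'·Cov_ν(F, 1_{G_y}) ≥ 0`, memo g13 §5's residue): the conjecture at the antitone functional `E[F | C_X]`
  (`BHK2006.condS_antitone`) plus `Consts.hnu_ge_hnu_condS`.
* `Consts.mdlxJoint_indicator_of_avoidedClusterRepulsion` — **dual H-ν ⟹ `Consts.MDLXJoint` at the indicator of every up-event `U` of `C_s`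
  with `μ(T)·μ(U∩T∩W) ≤ μ(T∩W)·μ(U∩T)`** (`P(y↔z | T, U) ≤ p'`, equivalently `P(y↔z | T, Uᶜ) ≥ p'`; this sign condition holds in all but
  2–3 % of the gen-13/14 census instances and is the only thing separating H-ν from MDL(X)′, by `Consts.mdlx_indicator_eq_hnu_add`).
* `Consts.mdlx_eq_hnu_add` — the functional form of the identity: `MDLX(F) = Hν(F) + μ(D)·[μ(T∩W)∫_T F(C_s) − μ(T)∫_{T∩W} F(C_s)]` for EVERY `F`;
  `Consts.mdlxJoint_of_avoidedClusterRepulsion` — **dual H-ν ⟹ the body of `Consts.MDLXJoint` at `(n,w,s,y,z,X,F)` for every monotone `F` with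
  `μ(T)·∫_{T∩W} F(C_s) ≤ μ(T∩W)·∫_T F(C_s)`** (`E[F(C_s) | T, y↔z] ≤ E[F(C_s) | T]`).
[cite: VandenbergHaggstromKahn2005, §2.1 pp. 9–13 (Lemma 2.4, Remark 2.8)]
-/

noncomputable section

namespace Summit.CriticalPhenomena.PercolationContinuityZ3.Theorems

open MeasureTheory Set Literature.Probability.LatticeModels Literature.Probability.Percolation
open Literature.Probability.Percolation.BHK2006
open Literature.Probability.Percolation.DecisionTree (ind ind_of_mem ind_of_not_mem ind_nonneg)
open scoped Classical

namespace Consts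

/-- **Dual H-ν ⟹ H-ν for every monotone functional of `C_s`.**  For `μ = prodBernoulli w` on `Fin n`, owner `s`, avoided set `X`,
markers `y, z` and `F` monotone:
`0 ≤ μ(T)[μ(D)∫_{D∩B'} F(C_s) − (∫_D F(C_s)) μ(D∩B')] + μ(T∩W)[μ(D)∫_{D∩G_y} F(C_s) − (∫_D F(C_s)) μ(D∩G_y)]`.
Proof: `Consts.AvoidedClusterRepulsion` at `g = E[F | C_X]` (antitone, `BHK2006.condS_antitone`) and `Consts.hnu_ge_hnu_condS`.
[cite: VandenbergHaggstromKahn2005, §2.1 Lemma 2.4 (p. 10), Remark 2.8 (p. 12)] -/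
theorem hnu_of_avoidedClusterRepulsion (h : AvoidedClusterRepulsion) (n : ℕ) (w : Sym2 (Fin n) → unitInterval)
    (s y z : Fin n) (X : Set (Fin n)) {F : Set (Sym2 (Fin n)) → ℝ} (hF : Monotone F) :
    0 ≤ (prodBernoulli w).real ({ω : BondConfig (Fin n) | ∀ x ∈ insert s X, ¬ (openGraph ω).Reachable y x} ∩
          {ω | ∀ x ∈ X, ¬ (openGraph ω).Reachable s x}) *
        ((prodBernoulli w).real {ω : BondConfig (Fin n) | ∀ x ∈ X, ¬ (openGraph ω).Reachable s x} *
            (∫ ω in {ω : BondConfig (Fin n) | ∀ x ∈ X, ¬ (openGraph ω).Reachable s x} ∩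
                (openConn s z ∪ (openConn y z ∩ {ω | ∀ x ∈ X, ¬ (openGraph ω).Reachable y x})),
              F (openEdgeCluster ω s) ∂(prodBernoulli w)) -
          (∫ ω in {ω : BondConfig (Fin n) | ∀ x ∈ X, ¬ (openGraph ω).Reachable s x},
              F (openEdgeCluster ω s) ∂(prodBernoulli w)) *
            (prodBernoulli w).real ({ω : BondConfig (Fin n) | ∀ x ∈ X, ¬ (openGraph ω).Reachable s x} ∩
              (openConn s z ∪ (openConn y z ∩ {ω | ∀ x ∈ X, ¬ (openGraph ω).Reachable y x})))) +
      (prodBernoulli w).real ({ω : BondConfig (Fin n) | ∀ x ∈ insert s X, ¬ (openGraph ω).Reachable y x} ∩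
          {ω | ∀ x ∈ X, ¬ (openGraph ω).Reachable s x} ∩ openConn y z) *
        ((prodBernoulli w).real {ω : BondConfig (Fin n) | ∀ x ∈ X, ¬ (openGraph ω).Reachable s x} *
            (∫ ω in {ω : BondConfig (Fin n) | ∀ x ∈ X, ¬ (openGraph ω).Reachable s x} ∩
                {ω | ∃ x ∈ X, (openGraph ω).Reachable y x},
              F (openEdgeCluster ω s) ∂(prodBernoulli w)) -
          (∫ ω in {ω : BondConfig (Fin n) | ∀ x ∈ X, ¬ (openGraph ω).Reachable s x},
              F (openEdgeCluster ω s) ∂(prodBernoulli w)) *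
            (prodBernoulli w).real ({ω : BondConfig (Fin n) | ∀ x ∈ X, ¬ (openGraph ω).Reachable s x} ∩
              {ω | ∃ x ∈ X, (openGraph ω).Reachable y x})) := by
  have hw0 : ∀ e, 0 ≤ (fun e => (w e : ℝ)) e := fun e => (w e).2.1
  have hw1 : ∀ e, (fun e => (w e : ℝ)) e ≤ 1 := fun e => (w e).2.2
  have key := h n w s y z X (condS (fun e => (w e : ℝ)) {s} X F) (condS_antitone hw0 hw1 {s} X hF)
  exact key.trans (hnu_ge_hnu_condS w s y z X hF)

/-- **Dual H-ν ⟹ `Consts.MDLXJoint` at every up-event of `C_s` that does not raise the three-way link probability.**  For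
`μ = prodBernoulli w` on `Fin n`, owner `s`, avoided set `X`, markers `y, z`, an up-event `U` of the open edge cluster of `s` with
`μ(T)·μ(U∩T∩W) ≤ μ(T∩W)·μ(U∩T)` (`T = {y ↮ {s}∪X} ∩ {s ↮ X}`, `W = {y↔z}`; i.e. `P(y↔z | T, U) ≤ p'`):
`μ(T∩W)·[μ(D)μ(D∩U∩Y) − μ(D∩U)μ(D∩Y)] ≤ μ(T)·[μ(D)μ(D∩U∩Z) − μ(D∩U)μ(D∩Z)]` — `Consts.hnu_of_avoidedClusterRepulsion` at the monotone
indicator functional `C ↦ 1{∃ ω ∈ U, C_s(ω) ⊆ C}` and `Consts.mdlxJoint_indicator_of_hnu`.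
[cite: VandenbergHaggstromKahn2005, §2.1 pp. 9–13 — corollary, derived here] -/
theorem mdlxJoint_indicator_of_avoidedClusterRepulsion (h : AvoidedClusterRepulsion) (n : ℕ) (w : Sym2 (Fin n) → unitInterval)
    (s y z : Fin n) (X : Set (Fin n)) (U : Set (BondConfig (Fin n)))
    (hU : ∀ ⦃ω ω' : BondConfig (Fin n)⦄, openEdgeCluster ω s ⊆ openEdgeCluster ω' s → ω ∈ U → ω' ∈ U)
    (hlink : (prodBernoulli w).real ({ω : BondConfig (Fin n) | ∀ x ∈ insert s X, ¬ (openGraph ω).Reachable y x} ∩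
            {ω | ∀ x ∈ X, ¬ (openGraph ω).Reachable s x}) *
          (prodBernoulli w).real (U ∩ ({ω : BondConfig (Fin n) | ∀ x ∈ insert s X, ¬ (openGraph ω).Reachable y x} ∩
            {ω | ∀ x ∈ X, ¬ (openGraph ω).Reachable s x} ∩ openConn y z)) ≤
        (prodBernoulli w).real ({ω : BondConfig (Fin n) | ∀ x ∈ insert s X, ¬ (openGraph ω).Reachable y x} ∩
            {ω | ∀ x ∈ X, ¬ (openGraph ω).Reachable s x} ∩ openConn y z) *
          (prodBernoulli w).real (U ∩ ({ω : BondConfig (Fin n) | ∀ x ∈ insert s X, ¬ (openGraph ω).Reachable y x} ∩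
            {ω | ∀ x ∈ X, ¬ (openGraph ω).Reachable s x}))) :
    (prodBernoulli w).real ({ω : BondConfig (Fin n) | ∀ x ∈ insert s X, ¬ (openGraph ω).Reachable y x} ∩
          {ω | ∀ x ∈ X, ¬ (openGraph ω).Reachable s x} ∩ openConn y z) *
        ((prodBernoulli w).real {ω : BondConfig (Fin n) | ∀ x ∈ X, ¬ (openGraph ω).Reachable s x} *
            (prodBernoulli w).real ({ω : BondConfig (Fin n) | ∀ x ∈ X, ¬ (openGraph ω).Reachable s x} ∩ U ∩ openConn s y) -
          (prodBernoulli w).real ({ω : BondConfig (Fin n) | ∀ x ∈ X, ¬ (openGraph ω).Reachable s x} ∩ U) *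
            (prodBernoulli w).real ({ω : BondConfig (Fin n) | ∀ x ∈ X, ¬ (openGraph ω).Reachable s x} ∩ openConn s y)) ≤
      (prodBernoulli w).real ({ω : BondConfig (Fin n) | ∀ x ∈ insert s X, ¬ (openGraph ω).Reachable y x} ∩
          {ω | ∀ x ∈ X, ¬ (openGraph ω).Reachable s x}) *
        ((prodBernoulli w).real {ω : BondConfig (Fin n) | ∀ x ∈ X, ¬ (openGraph ω).Reachable s x} *
            (prodBernoulli w).real ({ω : BondConfig (Fin n) | ∀ x ∈ X, ¬ (openGraph ω).Reachable s x} ∩ U ∩ openConn s z) -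
          (prodBernoulli w).real ({ω : BondConfig (Fin n) | ∀ x ∈ X, ¬ (openGraph ω).Reachable s x} ∩ U) *
            (prodBernoulli w).real ({ω : BondConfig (Fin n) | ∀ x ∈ X, ¬ (openGraph ω).Reachable s x} ∩ openConn s z)) := by
  classical
  set μ := prodBernoulli w with hμ
  -- the monotone indicator functional of `U` read on `C_s`
  set F : Set (Sym2 (Fin n)) → ℝ := fun C => if (∃ ω' ∈ U, openEdgeCluster ω' s ⊆ C) then (1 : ℝ) else 0 with hFdef
  have hF : Monotone F := by
    refine TripodExchange.predIndicator_monotone ?_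
    rintro C C' hCC' ⟨ω', hω', hsub⟩
    exact ⟨ω', hω', hsub.trans hCC'⟩
  have hFU : ∀ ω : BondConfig (Fin n), F (openEdgeCluster ω s) = U.indicator (1 : BondConfig (Fin n) → ℝ) ω := by
    intro ω
    by_cases hω : ω ∈ U
    · rw [indicator_of_mem hω, Pi.one_apply, hFdef]; simp only
      rw [if_pos ⟨ω, hω, Subset.rfl⟩]
    · rw [indicator_of_notMem hω, hFdef]; simp only
      rw [if_neg]
      rintro ⟨ω', hω', hsub⟩
      exact hω (hU hsub hω')
  have key := hnu_of_avoidedClusterRepulsion h n w s y z X hF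
  simp only [hFU, TripodExchange.setIntegral_indicator_one_eq] at key
  rw [Set.inter_right_comm {ω : BondConfig (Fin n) | ∀ x ∈ X, ¬ (openGraph ω).Reachable s x}
      (openConn s z ∪ (openConn y z ∩ {ω | ∀ x ∈ X, ¬ (openGraph ω).Reachable y x})) U,
    Set.inter_right_comm {ω : BondConfig (Fin n) | ∀ x ∈ X, ¬ (openGraph ω).Reachable s x}
      {ω | ∃ x ∈ X, (openGraph ω).Reachable y x} U] at key
  exact mdlxJoint_indicator_of_hnu w s y z X U key hlink

/-! ### The functional form: `MDLX(F) = Hν(F) + μ(D)·[μ(T∩W)∫_T F − μ(T)∫_{T∩W} F]` and MDL(X)′ for functionals from the conjecture -/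

/-- A set integral as a weighted sum with the indicator `ind`. [folklore] -/
private theorem setIntegral_eq_sum_ind' {V : Type*} [Fintype V] (w : Sym2 V → unitInterval) (S : Set (BondConfig V))
    (ψ : BondConfig V → ℝ) :
    ∫ ω in S, ψ ω ∂(prodBernoulli w) = ∑ ω, weight (fun e => (w e : ℝ)) ω * (ψ ω * ind S ω) := by
  rw [← integral_indicator (MeasurableSet.of_discrete), integral_prodBernoulli_eq_sum]
  refine Finset.sum_congr rfl fun ω _ => ?_
  by_cases hω : ω ∈ S
  · rw [Set.indicator_of_mem hω, ind_of_mem hω, mul_one]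
  · simp [Set.indicator_of_notMem hω, ind_of_not_mem hω]

/-- A measure as a weighted sum with the indicator `ind`. [folklore] -/
private theorem real_eq_sum_ind' {V : Type*} [Fintype V] (w : Sym2 V → unitInterval) (S : Set (BondConfig V)) :
    (prodBernoulli w).real S = ∑ ω, weight (fun e => (w e : ℝ)) ω * ind S ω := by
  rw [← integral_indicator_one (MeasurableSet.of_discrete), integral_prodBernoulli_eq_sum]
  refine Finset.sum_congr rfl fun ω _ => ?_
  by_cases hω : ω ∈ S
  · rw [Set.indicator_of_mem hω, ind_of_mem hω, Pi.one_apply]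
  · rw [Set.indicator_of_notMem hω, ind_of_not_mem hω, mul_zero]

/-- **EXACT IDENTITY, functional form: `MDLX(F) = Hν(F) + μ(D)·[μ(T∩W)∫_T F(C_s) − μ(T)∫_{T∩W} F(C_s)]`** for EVERY `F` (no monotonicity), where
`MDLX(F) = μ(T)[μ(D)∫_{D∩Z}F − (∫_D F)μ(D∩Z)] − μ(T∩W)[μ(D)∫_{D∩Y}F − (∫_D F)μ(D∩Y)]` is the margin of `Consts.MDLXJoint` and
`Hν(F) = μ(T)[μ(D)∫_{D∩B'}F − (∫_D F)μ(D∩B')] + μ(T∩W)[μ(D)∫_{D∩G_y}F − (∫_D F)μ(D∩G_y)]`.  Bookkeeping on the partitions `D∩B' = (D∩Z) ⊔ (T∩W)`,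
`D = (D∩Y) ⊔ (D∩G_y) ⊔ T` (the event form is `Consts.mdlx_indicator_eq_hnu_add`). [cite: VandenbergHaggstromKahn2005, §2.1 pp. 10–13 — identity, derived here] -/
theorem mdlx_eq_hnu_add {V : Type*} [Fintype V] (w : Sym2 V → unitInterval) (s y z : V) (X : Set V) (F : Set (Sym2 V) → ℝ) :
    (prodBernoulli w).real ({ω : BondConfig V | ∀ x ∈ insert s X, ¬ (openGraph ω).Reachable y x} ∩
          {ω | ∀ x ∈ X, ¬ (openGraph ω).Reachable s x}) *
        ((prodBernoulli w).real {ω : BondConfig V | ∀ x ∈ X, ¬ (openGraph ω).Reachable s x} *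
            (∫ ω in {ω : BondConfig V | ∀ x ∈ X, ¬ (openGraph ω).Reachable s x} ∩ openConn s z,
              F (openEdgeCluster ω s) ∂(prodBernoulli w)) -
          (∫ ω in {ω : BondConfig V | ∀ x ∈ X, ¬ (openGraph ω).Reachable s x},
              F (openEdgeCluster ω s) ∂(prodBernoulli w)) *
            (prodBernoulli w).real ({ω : BondConfig V | ∀ x ∈ X, ¬ (openGraph ω).Reachable s x} ∩ openConn s z)) -
      (prodBernoulli w).real ({ω : BondConfig V | ∀ x ∈ insert s X, ¬ (openGraph ω).Reachable y x} ∩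
          {ω | ∀ x ∈ X, ¬ (openGraph ω).Reachable s x} ∩ openConn y z) *
        ((prodBernoulli w).real {ω : BondConfig V | ∀ x ∈ X, ¬ (openGraph ω).Reachable s x} *
            (∫ ω in {ω : BondConfig V | ∀ x ∈ X, ¬ (openGraph ω).Reachable s x} ∩ openConn s y,
              F (openEdgeCluster ω s) ∂(prodBernoulli w)) -
          (∫ ω in {ω : BondConfig V | ∀ x ∈ X, ¬ (openGraph ω).Reachable s x},
              F (openEdgeCluster ω s) ∂(prodBernoulli w)) *
            (prodBernoulli w).real ({ω : BondConfig V | ∀ x ∈ X, ¬ (openGraph ω).Reachable s x} ∩ openConn s y)) =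
    ((prodBernoulli w).real ({ω : BondConfig V | ∀ x ∈ insert s X, ¬ (openGraph ω).Reachable y x} ∩
          {ω | ∀ x ∈ X, ¬ (openGraph ω).Reachable s x}) *
        ((prodBernoulli w).real {ω : BondConfig V | ∀ x ∈ X, ¬ (openGraph ω).Reachable s x} *
            (∫ ω in {ω : BondConfig V | ∀ x ∈ X, ¬ (openGraph ω).Reachable s x} ∩
                (openConn s z ∪ (openConn y z ∩ {ω | ∀ x ∈ X, ¬ (openGraph ω).Reachable y x})),
              F (openEdgeCluster ω s) ∂(prodBernoulli w)) -
          (∫ ω in {ω : BondConfig V | ∀ x ∈ X, ¬ (openGraph ω).Reachable s x},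
              F (openEdgeCluster ω s) ∂(prodBernoulli w)) *
            (prodBernoulli w).real ({ω : BondConfig V | ∀ x ∈ X, ¬ (openGraph ω).Reachable s x} ∩
              (openConn s z ∪ (openConn y z ∩ {ω | ∀ x ∈ X, ¬ (openGraph ω).Reachable y x})))) +
      (prodBernoulli w).real ({ω : BondConfig V | ∀ x ∈ insert s X, ¬ (openGraph ω).Reachable y x} ∩
          {ω | ∀ x ∈ X, ¬ (openGraph ω).Reachable s x} ∩ openConn y z) *
        ((prodBernoulli w).real {ω : BondConfig V | ∀ x ∈ X, ¬ (openGraph ω).Reachable s x} *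
            (∫ ω in {ω : BondConfig V | ∀ x ∈ X, ¬ (openGraph ω).Reachable s x} ∩ {ω | ∃ x ∈ X, (openGraph ω).Reachable y x},
              F (openEdgeCluster ω s) ∂(prodBernoulli w)) -
          (∫ ω in {ω : BondConfig V | ∀ x ∈ X, ¬ (openGraph ω).Reachable s x},
              F (openEdgeCluster ω s) ∂(prodBernoulli w)) *
            (prodBernoulli w).real ({ω : BondConfig V | ∀ x ∈ X, ¬ (openGraph ω).Reachable s x} ∩
              {ω | ∃ x ∈ X, (openGraph ω).Reachable y x}))) +
    (prodBernoulli w).real {ω : BondConfig V | ∀ x ∈ X, ¬ (openGraph ω).Reachable s x} *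
      ((prodBernoulli w).real ({ω : BondConfig V | ∀ x ∈ insert s X, ¬ (openGraph ω).Reachable y x} ∩
            {ω | ∀ x ∈ X, ¬ (openGraph ω).Reachable s x} ∩ openConn y z) *
          (∫ ω in {ω : BondConfig V | ∀ x ∈ insert s X, ¬ (openGraph ω).Reachable y x} ∩
              {ω | ∀ x ∈ X, ¬ (openGraph ω).Reachable s x}, F (openEdgeCluster ω s) ∂(prodBernoulli w)) -
        (prodBernoulli w).real ({ω : BondConfig V | ∀ x ∈ insert s X, ¬ (openGraph ω).Reachable y x} ∩
            {ω | ∀ x ∈ X, ¬ (openGraph ω).Reachable s x}) *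
          (∫ ω in {ω : BondConfig V | ∀ x ∈ insert s X, ¬ (openGraph ω).Reachable y x} ∩
              {ω | ∀ x ∈ X, ¬ (openGraph ω).Reachable s x} ∩ openConn y z, F (openEdgeCluster ω s) ∂(prodBernoulli w))) := by
  classical
  set wr : Sym2 V → ℝ := fun e => (w e : ℝ) with hwr
  set D : Set (BondConfig V) := {ω | ∀ x ∈ X, ¬ (openGraph ω).Reachable s x} with hD
  set A : Set (BondConfig V) := {ω | ∀ x ∈ insert s X, ¬ (openGraph ω).Reachable y x} with hA
  set Ay : Set (BondConfig V) := {ω | ∀ x ∈ X, ¬ (openGraph ω).Reachable y x} with hAy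
  set Gy : Set (BondConfig V) := {ω | ∃ x ∈ X, (openGraph ω).Reachable y x} with hGy
  set Yv : Set (BondConfig V) := openConn s y with hYv
  set Zv : Set (BondConfig V) := openConn s z with hZv
  set Wv : Set (BondConfig V) := openConn y z with hWv
  set Bp : Set (BondConfig V) := Zv ∪ (Wv ∩ Ay) with hBp
  have mA : ∀ ω, ω ∈ A ↔ ¬ (openGraph ω).Reachable y s ∧ ∀ x ∈ X, ¬ (openGraph ω).Reachable y x := by
    intro ω; simp only [hA, mem_setOf_eq, mem_insert_iff, forall_eq_or_imp]
  have mD : ∀ ω, ω ∈ D ↔ ∀ x ∈ X, ¬ (openGraph ω).Reachable s x := fun ω => Iff.rfl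
  have mAy : ∀ ω, ω ∈ Ay ↔ ∀ x ∈ X, ¬ (openGraph ω).Reachable y x := fun ω => Iff.rfl
  have mGy : ∀ ω, ω ∈ Gy ↔ ∃ x ∈ X, (openGraph ω).Reachable y x := fun ω => Iff.rfl
  have mY : ∀ ω, ω ∈ Yv ↔ (openGraph ω).Reachable s y := fun ω => Iff.rfl
  have mZ : ∀ ω, ω ∈ Zv ↔ (openGraph ω).Reachable s z := fun ω => Iff.rfl
  have mW : ∀ ω, ω ∈ Wv ↔ (openGraph ω).Reachable y z := fun ω => Iff.rfl
  have mBp : ∀ ω, ω ∈ Bp ↔ ω ∈ Zv ∨ (ω ∈ Wv ∧ ω ∈ Ay) := fun ω => by simp only [hBp, mem_union, mem_inter_iff]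
  -- pointwise indicator identities: `1_{D∩B'} = 1_{D∩Z} + 1_{T∩W}` and `1_D = 1_{D∩Y} + 1_{D∩G_y} + 1_T`
  have i1 : ∀ ω, ind (D ∩ Bp) ω = ind (D ∩ Zv) ω + ind (A ∩ D ∩ Wv) ω := by
    intro ω
    by_cases hd : ω ∈ D
    · by_cases hz : ω ∈ Zv
      · have hnT : ω ∉ A ∩ D ∩ Wv := by
          rintro ⟨⟨hAω, -⟩, hyz⟩
          rw [mA] at hAω
          exact hAω.1 ((show (openGraph ω).Reachable y z from hyz).trans (show (openGraph ω).Reachable s z from hz).symm)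
        rw [ind_of_mem (show ω ∈ D ∩ Bp from ⟨hd, (mBp ω).2 (Or.inl hz)⟩), ind_of_mem (show ω ∈ D ∩ Zv from ⟨hd, hz⟩),
          ind_of_not_mem hnT, add_zero]
      · rw [ind_of_not_mem (fun h : ω ∈ D ∩ Zv => hz h.2), zero_add]
        by_cases ht : ω ∈ A ∩ D ∩ Wv
        · have hb : ω ∈ D ∩ Bp := ⟨hd, (mBp ω).2 (Or.inr ⟨ht.2, ((mA ω).1 ht.1.1).2⟩)⟩
          rw [ind_of_mem hb, ind_of_mem ht]
        · have hnb : ω ∉ D ∩ Bp := by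
            rintro ⟨-, hb⟩
            rcases (mBp ω).1 hb with hz' | ⟨hyz, hay⟩
            · exact hz hz'
            · exact ht ⟨⟨(mA ω).2 ⟨fun hys => hz (hys.symm.trans hyz), hay⟩, hd⟩, hyz⟩
          rw [ind_of_not_mem hnb, ind_of_not_mem ht]
    · rw [ind_of_not_mem (fun h : ω ∈ D ∩ Bp => hd h.1), ind_of_not_mem (fun h : ω ∈ D ∩ Zv => hd h.1),
        ind_of_not_mem (fun h : ω ∈ A ∩ D ∩ Wv => hd h.1.2), add_zero]
  have i2 : ∀ ω, ind D ω = ind (D ∩ Yv) ω + ind (D ∩ Gy) ω + ind (A ∩ D) ω := by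
    intro ω
    by_cases hd : ω ∈ D
    · rw [ind_of_mem hd]
      by_cases hy : ω ∈ Yv
      · have h2 : ω ∉ D ∩ Gy := by
          rintro ⟨-, ⟨x, hx, hyx⟩⟩; exact hd x hx ((show (openGraph ω).Reachable s y from hy).trans hyx)
        have h3 : ω ∉ A ∩ D := by
          rintro ⟨hAω, -⟩; exact ((mA ω).1 hAω).1 (show (openGraph ω).Reachable s y from hy).symm
        rw [ind_of_mem (show ω ∈ D ∩ Yv from ⟨hd, hy⟩), ind_of_not_mem h2, ind_of_not_mem h3]; ring
      · rw [ind_of_not_mem (fun h : ω ∈ D ∩ Yv => hy h.2), zero_add]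
        by_cases hg : ω ∈ Gy
        · have h3 : ω ∉ A ∩ D := by
            rintro ⟨hAω, -⟩; obtain ⟨x, hx, hyx⟩ := hg; exact ((mA ω).1 hAω).2 x hx hyx
          rw [ind_of_mem (show ω ∈ D ∩ Gy from ⟨hd, hg⟩), ind_of_not_mem h3]; ring
        · have h3 : ω ∈ A ∩ D := by
            refine ⟨(mA ω).2 ⟨fun hys => hy hys.symm, fun x hx hyx => hg ⟨x, hx, hyx⟩⟩, hd⟩
          rw [ind_of_not_mem (fun h : ω ∈ D ∩ Gy => hg h.2), ind_of_mem h3]; ring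
    · rw [ind_of_not_mem hd, ind_of_not_mem (fun h : ω ∈ D ∩ Yv => hd h.1), ind_of_not_mem (fun h : ω ∈ D ∩ Gy => hd h.1),
        ind_of_not_mem (fun h : ω ∈ A ∩ D => hd h.2)]; ring
  -- convert every integral / measure to a weighted sum and split
  simp only [setIntegral_eq_sum_ind' w, real_eq_sum_ind' w]
  have e1 : ∑ ω, weight wr ω * (F (openEdgeCluster ω s) * ind (D ∩ Bp) ω) =
      ∑ ω, weight wr ω * (F (openEdgeCluster ω s) * ind (D ∩ Zv) ω) + ∑ ω, weight wr ω * (F (openEdgeCluster ω s) * ind (A ∩ D ∩ Wv) ω) := by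
    rw [← Finset.sum_add_distrib]; exact Finset.sum_congr rfl fun ω _ => by rw [i1 ω]; ring
  have e2 : ∑ ω, weight wr ω * ind (D ∩ Bp) ω = ∑ ω, weight wr ω * ind (D ∩ Zv) ω + ∑ ω, weight wr ω * ind (A ∩ D ∩ Wv) ω := by
    rw [← Finset.sum_add_distrib]; exact Finset.sum_congr rfl fun ω _ => by rw [i1 ω]; ring
  have e3 : ∑ ω, weight wr ω * (F (openEdgeCluster ω s) * ind D ω) =
      ∑ ω, weight wr ω * (F (openEdgeCluster ω s) * ind (D ∩ Yv) ω) + ∑ ω, weight wr ω * (F (openEdgeCluster ω s) * ind (D ∩ Gy) ω) +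
        ∑ ω, weight wr ω * (F (openEdgeCluster ω s) * ind (A ∩ D) ω) := by
    rw [← Finset.sum_add_distrib, ← Finset.sum_add_distrib]; exact Finset.sum_congr rfl fun ω _ => by rw [i2 ω]; ring
  have e4 : ∑ ω, weight wr ω * ind D ω =
      ∑ ω, weight wr ω * ind (D ∩ Yv) ω + ∑ ω, weight wr ω * ind (D ∩ Gy) ω + ∑ ω, weight wr ω * ind (A ∩ D) ω := by
    rw [← Finset.sum_add_distrib, ← Finset.sum_add_distrib]; exact Finset.sum_congr rfl fun ω _ => by rw [i2 ω]; ring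
  rw [e1, e2]
  linear_combination ((∑ ω, weight wr ω * ind (A ∩ D ∩ Wv) ω) * ∑ ω, weight wr ω * ind D ω) * e3 -
    ((∑ ω, weight wr ω * ind (A ∩ D ∩ Wv) ω) * ∑ ω, weight wr ω * (F (openEdgeCluster ω s) * ind D ω)) * e4

/-- **Dual H-ν ⟹ the `Consts.MDLXJoint` inequality at every monotone functional `F` whose three-way link correction is nonnegative**, i.e. with
`μ(T)·∫_{T∩W} F(C_s) ≤ μ(T∩W)·∫_T F(C_s)` (`E[F | T, y↔z] ≤ E[F | T]`: on the three-way separation event the functional does not prefer the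
`y–z` link): `μ(T∩W)[μ(D)∫_{D∩Y}F − (∫_DF)μ(D∩Y)] ≤ μ(T)[μ(D)∫_{D∩Z}F − (∫_DF)μ(D∩Z)]` — exactly the body of `Consts.MDLXJoint` at `(n,w,s,y,z,X,F)`.
[cite: VandenbergHaggstromKahn2005, §2.1 pp. 9–13 — corollary, derived here] -/
theorem mdlxJoint_of_avoidedClusterRepulsion (h : AvoidedClusterRepulsion) (n : ℕ) (w : Sym2 (Fin n) → unitInterval)
    (s y z : Fin n) (X : Set (Fin n)) {F : Set (Sym2 (Fin n)) → ℝ} (hF : Monotone F)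
    (hlink : (prodBernoulli w).real ({ω : BondConfig (Fin n) | ∀ x ∈ insert s X, ¬ (openGraph ω).Reachable y x} ∩
            {ω | ∀ x ∈ X, ¬ (openGraph ω).Reachable s x}) *
          (∫ ω in {ω : BondConfig (Fin n) | ∀ x ∈ insert s X, ¬ (openGraph ω).Reachable y x} ∩
              {ω | ∀ x ∈ X, ¬ (openGraph ω).Reachable s x} ∩ openConn y z, F (openEdgeCluster ω s) ∂(prodBernoulli w)) ≤
        (prodBernoulli w).real ({ω : BondConfig (Fin n) | ∀ x ∈ insert s X, ¬ (openGraph ω).Reachable y x} ∩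
            {ω | ∀ x ∈ X, ¬ (openGraph ω).Reachable s x} ∩ openConn y z) *
          (∫ ω in {ω : BondConfig (Fin n) | ∀ x ∈ insert s X, ¬ (openGraph ω).Reachable y x} ∩
              {ω | ∀ x ∈ X, ¬ (openGraph ω).Reachable s x}, F (openEdgeCluster ω s) ∂(prodBernoulli w))) :
    (prodBernoulli w).real ({ω : BondConfig (Fin n) | ∀ x ∈ insert s X, ¬ (openGraph ω).Reachable y x} ∩
          {ω | ∀ x ∈ X, ¬ (openGraph ω).Reachable s x} ∩ openConn y z) *
        ((prodBernoulli w).real {ω : BondConfig (Fin n) | ∀ x ∈ X, ¬ (openGraph ω).Reachable s x} *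
            (∫ ω in {ω : BondConfig (Fin n) | ∀ x ∈ X, ¬ (openGraph ω).Reachable s x} ∩ openConn s y,
              F (openEdgeCluster ω s) ∂(prodBernoulli w)) -
          (∫ ω in {ω : BondConfig (Fin n) | ∀ x ∈ X, ¬ (openGraph ω).Reachable s x},
              F (openEdgeCluster ω s) ∂(prodBernoulli w)) *
            (prodBernoulli w).real ({ω : BondConfig (Fin n) | ∀ x ∈ X, ¬ (openGraph ω).Reachable s x} ∩ openConn s y)) ≤
      (prodBernoulli w).real ({ω : BondConfig (Fin n) | ∀ x ∈ insert s X, ¬ (openGraph ω).Reachable y x} ∩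
          {ω | ∀ x ∈ X, ¬ (openGraph ω).Reachable s x}) *
        ((prodBernoulli w).real {ω : BondConfig (Fin n) | ∀ x ∈ X, ¬ (openGraph ω).Reachable s x} *
            (∫ ω in {ω : BondConfig (Fin n) | ∀ x ∈ X, ¬ (openGraph ω).Reachable s x} ∩ openConn s z,
              F (openEdgeCluster ω s) ∂(prodBernoulli w)) -
          (∫ ω in {ω : BondConfig (Fin n) | ∀ x ∈ X, ¬ (openGraph ω).Reachable s x},
              F (openEdgeCluster ω s) ∂(prodBernoulli w)) *
            (prodBernoulli w).real ({ω : BondConfig (Fin n) | ∀ x ∈ X, ¬ (openGraph ω).Reachable s x} ∩ openConn s z)) := by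
  have key := hnu_of_avoidedClusterRepulsion h n w s y z X hF
  have hid := mdlx_eq_hnu_add w s y z X F
  have h0 : 0 ≤ (prodBernoulli w).real {ω : BondConfig (Fin n) | ∀ x ∈ X, ¬ (openGraph ω).Reachable s x} := measureReal_nonneg
  nlinarith [hid, key, hlink, mul_nonneg h0 (sub_nonneg.2 hlink)]

end Consts

end Summit.CriticalPhenomena.PercolationContinuityZ3.Theorems

end
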